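import Literature.Probability.LatticeModels.SixVertexSpectralFTransform
import Mathlib.Analysis.Complex.HasPrimitives
import Mathlib.Analysis.Complex.CauchyIntegral

/-!
# Six-vertex spectral measures: `I_F` is analytic (DKLM 2026, Part II, Lemma 38 (i))

H. Duminil-Copin, K. K. Kozlowski, P. Lammers, I. Manolescu, *Gaussian free field convergence of
the six-vertex model with `-1 ≤ Δ ≤ -1/2`*, arXiv:2603.06268 (2026) [DKLM2026SixVertexGFF]
(`paper:arxiv-2603.06268`, chunk p0025):

> **Lemma 38.** For every convergence sequence `(δ_n)_n`, the functions `F` and `I_F` satisfy the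
> following properties. (i) The function `I_F` is analytic. […]
> *Proof.* The first property is straightforward since `F(·,0)` is analytic (Lemma 37 (iii)). […]

For the `F`-transform of any `μ ∈ 𝓜_{c,C}` (Definitions 29, 36), `I_F(s) = -∫₁^s F(x,0) dx` is real
analytic on `(0,∞)` (`analyticAt_dklmIF`): near `s₀ > 0`, `F(·,0)` is holomorphic on the disc
`B(s₀,s₀) ⊆ ℂ₊` (Lemma 37 (iii), `differentiableOn_dklmF`) and hence has a holomorphic primitive
`G` there (Morera / `DifferentiableOn.isExactOn_ball`), and `I_F(s) = I_F(s₀) - Re(G(s) - G(s₀))`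
by the fundamental theorem of calculus.

## References

* H. Duminil-Copin, K. K. Kozlowski, P. Lammers, I. Manolescu, arXiv:2603.06268 (2026), Part II,
  Lemma 38 (i) with Lemma 37 (iii). [DKLM2026SixVertexGFF]
-/

noncomputable section

open MeasureTheory Set Filter Topology Metric

namespace Literature.Probability.LatticeModels.SixVertex

section IF

variable {c C : ℝ} {μ : Measure (ℝ × ℝ)}

/-- The disc `B(s₀, s₀)` lies in the right half-plane. [folklore] -/
theorem ball_ofReal_subset_re_pos {s₀ : ℝ} : ball (s₀ : ℂ) s₀ ⊆ {x : ℂ | 0 < x.re} := by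
  intro z hz
  have h1 : ‖z - s₀‖ < s₀ := by rwa [mem_ball, dist_eq_norm] at hz
  have h2 := Complex.abs_re_le_norm (z - s₀)
  have h3 : (z - (s₀ : ℂ)).re = z.re - s₀ := by simp
  rw [h3] at h2
  show 0 < z.re
  have := neg_abs_le (z.re - s₀)
  linarith

/-- **Lemma 38 (i): `I_F` is (real) analytic on `(0,∞)`** for every `μ ∈ 𝓜_{c,C}`.
[cite: DKLM2026SixVertexGFF, Part II, Lemma 38 (i)] -/
theorem analyticAt_dklmIF (h : μ ∈ dklmSpaceM c C) {s₀ : ℝ} (hs₀ : 0 < s₀) : AnalyticAt ℝ (dklmIF μ) s₀ := by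
  -- a holomorphic primitive `G` of `F(·,0)` on the disc `B(s₀,s₀)`
  have hF : DifferentiableOn ℂ (fun x => dklmF μ x 0) (ball (s₀ : ℂ) s₀) :=
    (differentiableOn_dklmF h 0).mono ball_ofReal_subset_re_pos
  obtain ⟨G, hG⟩ := hF.isExactOn_ball
  have hGdiff : DifferentiableOn ℂ G (ball (s₀ : ℂ) s₀) := fun z hz => (hG z hz).differentiableAt.differentiableWithinAt
  have hGan : AnalyticAt ℂ G (s₀ : ℂ) := hGdiff.analyticAt (isOpen_ball.mem_nhds (mem_ball_self hs₀))
  -- its real restriction `g(x) = Re G(x)` has derivative `Re F(x,0)` on `(0, 2s₀)`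
  set g : ℝ → ℝ := fun x => (G x).re with hgdef
  have hmem : ∀ x ∈ Ioo 0 (2 * s₀), ((x : ℝ) : ℂ) ∈ ball (s₀ : ℂ) s₀ := by
    intro x hx
    rw [mem_ball, dist_eq_norm, ← Complex.ofReal_sub, Complex.norm_real, Real.norm_eq_abs, abs_lt]
    constructor <;> linarith [hx.1, hx.2]
  have hg : ∀ x ∈ Ioo 0 (2 * s₀), HasDerivAt g ((dklmF μ x 0).re) x := fun x hx =>
    (hG _ (hmem x hx)).real_of_complex
  have hgan : AnalyticAt ℝ g s₀ := by
    have h1 : AnalyticAt ℝ (fun x : ℝ => G (x : ℂ)) s₀ :=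
      (hGan.restrictScalars (𝕜 := ℝ)).comp (Complex.ofRealCLM.analyticAt s₀)
    exact (Complex.reCLM.analyticAt _).comp h1
  -- `I_F(s) = I_F(s₀) - (g s - g s₀)` near `s₀`
  have hcont : ContinuousOn (fun x : ℝ => (dklmF μ x 0).re) (Ioi 0) := continuousOn_dklmF_re h
  have heq : (fun s => dklmIF μ s₀ - (g s - g s₀)) =ᶠ[𝓝 s₀] dklmIF μ := by
    have hI : Ioo 0 (2 * s₀) ∈ 𝓝 s₀ := isOpen_Ioo.mem_nhds ⟨hs₀, by linarith⟩
    filter_upwards [hI] with s hs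
    have hsub : uIcc s₀ s ⊆ Ioo 0 (2 * s₀) := by
      rcases le_total s₀ s with hle | hle
      · rw [uIcc_of_le hle]; exact fun x hx => ⟨hs₀.trans_le hx.1, hx.2.trans_lt hs.2⟩
      · rw [uIcc_of_ge hle]; exact fun x hx => ⟨hs.1.trans_le hx.1, lt_of_le_of_lt hx.2 (by linarith)⟩
    have hsub' : uIcc s₀ s ⊆ Ioi 0 := fun x hx => (hsub hx).1
    have hint : IntervalIntegrable (fun x : ℝ => (dklmF μ x 0).re) volume s₀ s :=
      (hcont.mono hsub').intervalIntegrable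
    have hFTC : ∫ x in s₀..s, (dklmF μ x 0).re = g s - g s₀ :=
      intervalIntegral.integral_eq_sub_of_hasDerivAt (fun x hx => hg x (hsub hx)) hint
    have h1s₀ : IntervalIntegrable (fun x : ℝ => (dklmF μ x 0).re) volume 1 s₀ :=
      (hcont.mono fun x hx => show (0 : ℝ) < x from by
        rcases le_total 1 s₀ with h1 | h1
        · rw [uIcc_of_le h1] at hx; linarith [hx.1]
        · rw [uIcc_of_ge h1] at hx; linarith [hx.1]).intervalIntegrable
    rw [dklmIF, dklmIF, ← intervalIntegral.integral_add_adjacent_intervals h1s₀ hint, hFTC]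
    ring
  exact (analyticAt_const.sub (hgan.sub analyticAt_const)).congr heq

/-- **Lemma 38 (i)** on the whole half-line. [cite: DKLM2026SixVertexGFF, Part II, Lemma 38 (i)] -/
theorem analyticOnNhd_dklmIF (h : μ ∈ dklmSpaceM c C) : AnalyticOnNhd ℝ (dklmIF μ) (Ioi 0) :=
  fun _ hs => analyticAt_dklmIF h hs

end IF

end Literature.Probability.LatticeModels.SixVertex

end
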